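import Literature.NumberTheory.Automorphic.AdelicTensorStripping
import HarnessLib

/-!
# Finite places are exact: `𝒮((𝔸_K^∞)^{ι₁ ⊕ ι₂}) = 𝒮((𝔸_K^∞)^{ι₁}) ⊗ 𝒮((𝔸_K^∞)^{ι₂})`

Topic `NumberTheory/Automorphic`; namespace `Literature.NumberTheory.Automorphic`. Origin: `pub-hodgecm`
MODEL-CONSTRUCTION sub-cell, node W2-⊗ / (⊗S)-𝔸 (i) of RULING W2-⊗ (⊗S-split). KERNEL MATHEMATICS ONLY: every
declaration below is proved; no `def … : Prop` record, no cited hypothesis.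

For a direct sum of coordinate index sets `ι₁ ⊕ ι₂` the finite-adelic Schwartz–Bruhat space (locally constant,
compactly supported functions on the totally disconnected group `(𝔸_K^∞)^{ι₁ ⊕ ι₂}`) is the ALGEBRAIC tensor
product of the two factors:

* `finSumMap K ι₁ ι₂ : FinSB K ι₁ ⊗[ℂ] FinSB K ι₂ →ₗ[ℂ] ((ι₁ ⊕ ι₂ → 𝔸_K^∞) → ℂ)`, `f₁ ⊗ f₂ ↦ (v ↦ f₁(v|ι₁) f₂(v|ι₂))`,
  is injective (`finSumMap_injective`, linear disjointness of function tensors over a field — tree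
  `TensorFunctions.mulMap_injective`) with range EXACTLY `𝒮((𝔸_K^∞)^{ι₁ ⊕ ι₂})` (`range_finSumMap`: a
  Schwartz–Bruhat function has a level `𝔫` (tree `exists_level_of_mem_schwartzBruhat`), hence is a finite
  combination of indicators of cosets of the level box `(𝔫𝒪̂)^{ι₁ ⊕ ι₂}` (tree
  `exists_eq_sum_indicator_of_invariant`), and `𝟙_{c + (𝔫𝒪̂)^{ι₁ ⊕ ι₂}} = 𝟙_{c|ι₁ + (𝔫𝒪̂)^{ι₁}} ⊠ 𝟙_{c|ι₂ + (𝔫𝒪̂)^{ι₂}}`);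
* `finSumEquiv K ι₁ ι₂ : FinSB K ι₁ ⊗[ℂ] FinSB K ι₂ ≃ₗ[ℂ] FinSB K (ι₁ ⊕ ι₂)` — the resulting isomorphism;
* `finSumEnd B₁ B₂` — hence `B₁ ⊠ B₂` IS a linear endomorphism of `𝒮((𝔸_K^∞)^{ι₁ ⊕ ι₂})` for arbitrary linear
  `B_j` on the factors (`coe_finSumEnd_box`, functoriality `finSumEnd_id`/`finSumEnd_comp`, extensionality
  `linearMap_ext_box`);
* the adelic corollary: `𝒮(𝔸_K^{ι₁ ⊕ ι₂}) ≅ 𝓢((K ⊗ ℝ)^{ι₁ ⊕ ι₂}) ⊗ (FinSB K ι₁ ⊗ FinSB K ι₂)` (`piSchwartzBruhatSumEquiv`;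
  the ARCHIMEDEAN factor is deliberately NOT split — `𝓢(ℝ^{n+m})` is not the algebraic tensor product of
  `𝓢(ℝ^n)` and `𝓢(ℝ^m)`), the operators `A ⊗ (B₁ ⊠ B₂) = adelicTensorEnd A (finSumEnd B₁ B₂)` and the
  extensionality principle `linearMap_ext_arch_box` on the triple products `Φ_∞ ⊗ (f₁ ⊠ f₂)`.

## References

* [Weil1964] A. Weil, *Sur certains groupes d'opérateurs unitaires*, Acta Math. 111 (1964), n° 29 (standard
  functions on adelic vector spaces).
* [Tate1967] J. Tate, *Fourier analysis in number fields and Hecke's zeta-functions*, in Cassels–Fröhlich,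
  *Algebraic Number Theory* (1967), §3.2 (Schwartz–Bruhat functions on restricted products).
-/

noncomputable section

open NumberField NumberField.InfinitePlace NumberField.mixedEmbedding IsDedekindDomain Topology

open scoped SchwartzMap TensorProduct Pointwise Classical

namespace Literature.NumberTheory.Automorphic

/-! ## 1. Product functions on `(ι₁ ⊕ ι₂ → X)` -/

section Box

variable {X : Type*}

/-- Restriction of a vector indexed by `ι₁ ⊕ ι₂` to the `ι₁`-coordinates. [folklore] -/
abbrev resInl {ι₁ ι₂ : Type*} (v : ι₁ ⊕ ι₂ → X) : ι₁ → X := fun i => v (Sum.inl i)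

/-- Restriction of a vector indexed by `ι₁ ⊕ ι₂` to the `ι₂`-coordinates. [folklore] -/
abbrev resInr {ι₁ ι₂ : Type*} (v : ι₁ ⊕ ι₂ → X) : ι₂ → X := fun j => v (Sum.inr j)

/-- `(Sum.elim a b)|ι₁ = a`. [folklore] -/
@[simp] theorem resInl_elim {ι₁ ι₂ : Type*} (a : ι₁ → X) (b : ι₂ → X) :
    resInl (Sum.elim a b) = a := rfl

/-- `(Sum.elim a b)|ι₂ = b`. [folklore] -/
@[simp] theorem resInr_elim {ι₁ ι₂ : Type*} (a : ι₁ → X) (b : ι₂ → X) :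
    resInr (Sum.elim a b) = b := rfl

/-- The splitting `v ↦ (v|ι₁, v|ι₂)` is surjective. [folklore] -/
theorem surjective_resInl_resInr {ι₁ ι₂ : Type*} :
    Function.Surjective (fun v : ι₁ ⊕ ι₂ → X => (resInl v, resInr v)) :=
  fun p => ⟨Sum.elim p.1 p.2, rfl⟩

variable [AddGroup X]

/-- `(v + w)|ι₁ = v|ι₁ + w|ι₁`. [folklore] -/
theorem resInl_add {ι₁ ι₂ : Type*} (v w : ι₁ ⊕ ι₂ → X) : resInl (v + w) = resInl v + resInl w := rfl

/-- `(v + w)|ι₂ = v|ι₂ + w|ι₂`. [folklore] -/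
theorem resInr_add {ι₁ ι₂ : Type*} (v w : ι₁ ⊕ ι₂ → X) : resInr (v + w) = resInr v + resInr w := rfl

/-- `(-v)|ι₁ = -(v|ι₁)`. [folklore] -/
theorem resInl_neg {ι₁ ι₂ : Type*} (v : ι₁ ⊕ ι₂ → X) : resInl (-v) = -resInl v := rfl

/-- `(-v)|ι₂ = -(v|ι₂)`. [folklore] -/
theorem resInr_neg {ι₁ ι₂ : Type*} (v : ι₁ ⊕ ι₂ → X) : resInr (-v) = -resInr v := rfl

end Box

/-! ## 2. The multiplication map `𝒮((𝔸^∞)^{ι₁}) ⊗ 𝒮((𝔸^∞)^{ι₂}) → ((𝔸^∞)^{ι₁ ⊕ ι₂} → ℂ)` -/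

section FinSum

variable (K : Type) [Field K] [NumberField K] (ι₁ ι₂ : Type) [Fintype ι₁] [Fintype ι₂]

/-- **The multiplication map** `f₁ ⊗ f₂ ↦ (v ↦ f₁(v|ι₁) · f₂(v|ι₂))` from the algebraic tensor product of the
finite-adelic Schwartz–Bruhat spaces to functions on `(𝔸_K^∞)^{ι₁ ⊕ ι₂}`. [folklore] -/
def finSumMap : FinSB K ι₁ ⊗[ℂ] FinSB K ι₂ →ₗ[ℂ] ((ι₁ ⊕ ι₂ → FiniteAdeleRing (𝓞 K) K) → ℂ) :=
  LinearMap.funLeft ℂ ℂ (fun v : ι₁ ⊕ ι₂ → FiniteAdeleRing (𝓞 K) K => (resInl v, resInr v)) ∘ₗ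
    TensorFunctions.mulMap (SchwartzBruhat (ι₁ → FiniteAdeleRing (𝓞 K) K)).subtype
      (SchwartzBruhat (ι₂ → FiniteAdeleRing (𝓞 K) K)).subtype

omit [Fintype ι₁] [Fintype ι₂] in
/-- On pure tensors. [folklore] -/
@[simp] theorem finSumMap_tmul (f₁ : FinSB K ι₁) (f₂ : FinSB K ι₂) :
    finSumMap K ι₁ ι₂ (f₁ ⊗ₜ f₂) = fun v =>
      (f₁ : (ι₁ → FiniteAdeleRing (𝓞 K) K) → ℂ) (resInl v) *
        (f₂ : (ι₂ → FiniteAdeleRing (𝓞 K) K) → ℂ) (resInr v) := by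
  simp only [finSumMap, LinearMap.comp_apply, TensorFunctions.mulMap_tmul]
  rfl

omit [Fintype ι₁] [Fintype ι₂] in
/-- **Injectivity** of the multiplication map (linear disjointness over a field). [folklore] -/
theorem finSumMap_injective : Function.Injective (finSumMap K ι₁ ι₂) := by
  unfold finSumMap
  rw [LinearMap.coe_comp]
  exact (LinearMap.funLeft_injective_of_surjective ℂ ℂ _ surjective_resInl_resInr).comp
    (TensorFunctions.mulMap_injective _ _
      (SchwartzBruhat (ι₁ → FiniteAdeleRing (𝓞 K) K)).injective_subtype
      (SchwartzBruhat (ι₂ → FiniteAdeleRing (𝓞 K) K)).injective_subtype)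

variable {K ι₁ ι₂}

omit [Fintype ι₁] [Fintype ι₂] in
/-- **A product of Schwartz–Bruhat functions in separate variables is Schwartz–Bruhat** on
`(𝔸_K^∞)^{ι₁ ⊕ ι₂}`. [folklore] -/
theorem mul_res_mem_schwartzBruhat {f₁ : (ι₁ → FiniteAdeleRing (𝓞 K) K) → ℂ}
    {f₂ : (ι₂ → FiniteAdeleRing (𝓞 K) K) → ℂ}
    (hf₁ : f₁ ∈ SchwartzBruhat (ι₁ → FiniteAdeleRing (𝓞 K) K))
    (hf₂ : f₂ ∈ SchwartzBruhat (ι₂ → FiniteAdeleRing (𝓞 K) K)) :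
    (fun v : ι₁ ⊕ ι₂ → FiniteAdeleRing (𝓞 K) K => f₁ (resInl v) * f₂ (resInr v)) ∈
      SchwartzBruhat (ι₁ ⊕ ι₂ → FiniteAdeleRing (𝓞 K) K) := by
  obtain ⟨h₁lc, h₁cs⟩ := mem_schwartzBruhat_iff.1 hf₁
  obtain ⟨h₂lc, h₂cs⟩ := mem_schwartzBruhat_iff.1 hf₂
  have hc₁ : Continuous (fun v : ι₁ ⊕ ι₂ → FiniteAdeleRing (𝓞 K) K => resInl v) :=
    continuous_pi fun i => continuous_apply (Sum.inl i)
  have hc₂ : Continuous (fun v : ι₁ ⊕ ι₂ → FiniteAdeleRing (𝓞 K) K => resInr v) :=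
    continuous_pi fun j => continuous_apply (Sum.inr j)
  refine mem_schwartzBruhat_iff.2 ⟨(h₁lc.comp_continuous hc₁).mul (h₂lc.comp_continuous hc₂), ?_⟩
  -- compact support: the support lies in the image of `tsupport f₁ × tsupport f₂` under `Sum.elim`
  have hK : IsCompact ((fun p : (ι₁ → FiniteAdeleRing (𝓞 K) K) × (ι₂ → FiniteAdeleRing (𝓞 K) K) =>
      Sum.elim p.1 p.2) '' (tsupport f₁ ×ˢ tsupport f₂)) :=
    (h₁cs.isCompact.prod h₂cs.isCompact).image (by
      apply continuous_pi
      rintro (i | j)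
      · exact (continuous_apply i).comp continuous_fst
      · exact (continuous_apply j).comp continuous_snd)
  refine HasCompactSupport.intro hK fun v hv => ?_
  by_contra hne
  apply hv
  refine ⟨(resInl v, resInr v), ⟨?_, ?_⟩, ?_⟩
  · exact subset_tsupport _ (left_ne_zero_of_mul hne)
  · exact subset_tsupport _ (right_ne_zero_of_mul hne)
  · funext k
    rcases k with i | j <;> rfl

omit [Fintype ι₁] [Fintype ι₂] in
/-- **Indicator of a coset of a product box splits**: for subgroups `H_j ⊆ (𝔸^∞)^{ι_j}` and the box
`H = {v | v|ι₁ ∈ H₁ ∧ v|ι₂ ∈ H₂}`, `𝟙_{c + H}(v) = 𝟙_{c|ι₁ + H₁}(v|ι₁) · 𝟙_{c|ι₂ + H₂}(v|ι₂)`. [folklore] -/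
theorem indicator_vadd_box_eq_mul {X : Type*} [AddCommGroup X]
    (H₁ : AddSubgroup (ι₁ → X)) (H₂ : AddSubgroup (ι₂ → X)) (H : AddSubgroup (ι₁ ⊕ ι₂ → X))
    (hH : ∀ w, w ∈ H ↔ resInl w ∈ H₁ ∧ resInr w ∈ H₂) (c v : ι₁ ⊕ ι₂ → X) :
    (c +ᵥ (H : Set (ι₁ ⊕ ι₂ → X))).indicator (fun _ => (1 : ℂ)) v =
      (resInl c +ᵥ (H₁ : Set (ι₁ → X))).indicator (fun _ => (1 : ℂ)) (resInl v) *
        (resInr c +ᵥ (H₂ : Set (ι₂ → X))).indicator (fun _ => (1 : ℂ)) (resInr v) := by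
  have h := hH (-c + v)
  rw [resInl_add, resInr_add, resInl_neg, resInr_neg] at h
  by_cases h₁ : -resInl c + resInl v ∈ H₁
  · by_cases h₂ : -resInr c + resInr v ∈ H₂
    · rw [indicator_vadd_addSubgroup_of_mem H c 1 (h.2 ⟨h₁, h₂⟩),
        indicator_vadd_addSubgroup_of_mem H₁ _ 1 h₁, indicator_vadd_addSubgroup_of_mem H₂ _ 1 h₂, mul_one]
    · rw [indicator_vadd_addSubgroup_of_not_mem H c 1 (fun hc => h₂ (h.1 hc).2),
        indicator_vadd_addSubgroup_of_not_mem H₂ _ 1 h₂, mul_zero]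
  · rw [indicator_vadd_addSubgroup_of_not_mem H c 1 (fun hc => h₁ (h.1 hc).1),
      indicator_vadd_addSubgroup_of_not_mem H₁ _ 1 h₁, zero_mul]

omit [Fintype ι₁] [Fintype ι₂] in
/-- Membership in the level box over `ι₁ ⊕ ι₂` is membership of both restrictions. [folklore] -/
theorem mem_piLevelIdeal_sum_iff (𝔫 : Ideal (𝓞 K)) (w : ι₁ ⊕ ι₂ → FiniteAdeleRing (𝓞 K) K) :
    w ∈ piLevelIdeal K (ι₁ ⊕ ι₂) 𝔫 ↔ resInl w ∈ piLevelIdeal K ι₁ 𝔫 ∧ resInr w ∈ piLevelIdeal K ι₂ 𝔫 := by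
  simp only [mem_piLevelIdeal_iff]
  constructor
  · exact fun h => ⟨fun i => h (Sum.inl i), fun j => h (Sum.inr j)⟩
  · rintro ⟨h₁, h₂⟩ (i | j)
    · exact h₁ i
    · exact h₂ j

/-- **The indicator of a coset of a level box over `ι₁ ⊕ ι₂` is a product** `𝟙_{c|ι₁ + (𝔫𝒪̂)^{ι₁}} ⊠ 𝟙_{c|ι₂ + (𝔫𝒪̂)^{ι₂}}`,
hence in the range of `finSumMap`. [folklore] -/
theorem indicator_vadd_piLevelIdeal_mem_range_finSumMap (𝔫 : Ideal (𝓞 K))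
    (c : ι₁ ⊕ ι₂ → FiniteAdeleRing (𝓞 K) K) :
    (c +ᵥ (piLevelIdeal K (ι₁ ⊕ ι₂) 𝔫 : Set (ι₁ ⊕ ι₂ → FiniteAdeleRing (𝓞 K) K))).indicator
        (fun _ => (1 : ℂ)) ∈ LinearMap.range (finSumMap K ι₁ ι₂) := by
  refine ⟨⟨_, indicator_vadd_addSubgroup_mem_schwartzBruhat (piLevelIdeal K ι₁ 𝔫) (isOpen_piLevelIdeal K 𝔫)
      (isCompact_piLevelIdeal K ι₁ 𝔫) (resInl c) 1⟩ ⊗ₜ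
    ⟨_, indicator_vadd_addSubgroup_mem_schwartzBruhat (piLevelIdeal K ι₂ 𝔫) (isOpen_piLevelIdeal K 𝔫)
      (isCompact_piLevelIdeal K ι₂ 𝔫) (resInr c) 1⟩, ?_⟩
  rw [finSumMap_tmul]
  funext v
  exact (indicator_vadd_box_eq_mul (piLevelIdeal K ι₁ 𝔫) (piLevelIdeal K ι₂ 𝔫) (piLevelIdeal K (ι₁ ⊕ ι₂) 𝔫)
    (mem_piLevelIdeal_sum_iff 𝔫) c v).symm

variable (K ι₁ ι₂) in
/-- **The range of the multiplication map is exactly `𝒮((𝔸_K^∞)^{ι₁ ⊕ ι₂})`**: finite places are EXACT for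
the algebraic tensor product. [folklore] -/
theorem range_finSumMap :
    LinearMap.range (finSumMap K ι₁ ι₂) = SchwartzBruhat (ι₁ ⊕ ι₂ → FiniteAdeleRing (𝓞 K) K) := by
  apply le_antisymm
  · rintro _ ⟨t, rfl⟩
    induction t using TensorProduct.induction_on with
    | zero => rw [map_zero]; exact zero_mem _
    | tmul a b => rw [finSumMap_tmul]; exact mul_res_mem_schwartzBruhat a.2 b.2
    | add s t hs ht => rw [map_add]; exact add_mem hs ht
  · intro Φ hΦ
    obtain ⟨𝔫, -, hlev⟩ := exists_level_of_mem_schwartzBruhat K hΦ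
    obtain ⟨s, hs⟩ := exists_eq_sum_indicator_of_invariant (piLevelIdeal K (ι₁ ⊕ ι₂) 𝔫)
      (isOpen_piLevelIdeal K 𝔫) (mem_schwartzBruhat_iff.1 hΦ).2 hlev
    rw [hs]
    have hsum : (fun x => ∑ q ∈ s, Φ q.out *
        ((q.out : ι₁ ⊕ ι₂ → FiniteAdeleRing (𝓞 K) K) +ᵥ
          (piLevelIdeal K (ι₁ ⊕ ι₂) 𝔫 : Set (ι₁ ⊕ ι₂ → FiniteAdeleRing (𝓞 K) K))).indicator
            (fun _ => (1 : ℂ)) x) =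
        ∑ q ∈ s, Φ q.out • ((q.out : ι₁ ⊕ ι₂ → FiniteAdeleRing (𝓞 K) K) +ᵥ
          (piLevelIdeal K (ι₁ ⊕ ι₂) 𝔫 : Set (ι₁ ⊕ ι₂ → FiniteAdeleRing (𝓞 K) K))).indicator
            (fun _ => (1 : ℂ)) := by
      funext x
      rw [Finset.sum_apply]
      rfl
    rw [hsum]
    exact Submodule.sum_mem _ fun q _ =>
      Submodule.smul_mem _ _ (indicator_vadd_piLevelIdeal_mem_range_finSumMap 𝔫 q.out)

variable (K ι₁ ι₂) in
/-- **`𝒮((𝔸_K^∞)^{ι₁}) ⊗_ℂ 𝒮((𝔸_K^∞)^{ι₂}) ≅ 𝒮((𝔸_K^∞)^{ι₁ ⊕ ι₂})`** — the finite places are exact. [folklore] -/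
def finSumEquiv : FinSB K ι₁ ⊗[ℂ] FinSB K ι₂ ≃ₗ[ℂ] FinSB K (ι₁ ⊕ ι₂) :=
  (LinearEquiv.ofInjective _ (finSumMap_injective K ι₁ ι₂)).trans
    (LinearEquiv.ofEq _ _ (range_finSumMap K ι₁ ι₂))

/-- Underlying function of `finSumEquiv t`. [folklore] -/
@[simp] theorem coe_finSumEquiv (t : FinSB K ι₁ ⊗[ℂ] FinSB K ι₂) :
    ((finSumEquiv K ι₁ ι₂ t : FinSB K (ι₁ ⊕ ι₂)) : (ι₁ ⊕ ι₂ → FiniteAdeleRing (𝓞 K) K) → ℂ) =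
      finSumMap K ι₁ ι₂ t := rfl

/-- On pure tensors `finSumEquiv (f₁ ⊗ f₂) = f₁ ⊠ f₂`. [folklore] -/
theorem coe_finSumEquiv_tmul (f₁ : FinSB K ι₁) (f₂ : FinSB K ι₂) :
    ((finSumEquiv K ι₁ ι₂ (f₁ ⊗ₜ f₂) : FinSB K (ι₁ ⊕ ι₂)) : (ι₁ ⊕ ι₂ → FiniteAdeleRing (𝓞 K) K) → ℂ) =
      fun v => (f₁ : (ι₁ → FiniteAdeleRing (𝓞 K) K) → ℂ) (resInl v) *
        (f₂ : (ι₂ → FiniteAdeleRing (𝓞 K) K) → ℂ) (resInr v) := by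
  rw [coe_finSumEquiv, finSumMap_tmul]

/-- Every product `f₁ ⊠ f₂` is the image of the (unique) tensor `f₁ ⊗ f₂`. [folklore] -/
theorem finSumEquiv_symm_mul (f₁ : FinSB K ι₁) (f₂ : FinSB K ι₂) :
    (finSumEquiv K ι₁ ι₂).symm ⟨_, mul_res_mem_schwartzBruhat f₁.2 f₂.2⟩ = f₁ ⊗ₜ f₂ := by
  apply (finSumEquiv K ι₁ ι₂).injective
  rw [LinearEquiv.apply_symm_apply]
  apply Subtype.ext
  rw [coe_finSumEquiv_tmul]

/-- **Extensionality on products**: two linear maps out of `𝒮((𝔸_K^∞)^{ι₁ ⊕ ι₂})` that agree on all products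
`f₁ ⊠ f₂` are equal. [folklore] -/
theorem linearMap_ext_box {N : Type*} [AddCommMonoid N] [Module ℂ N] {F G : FinSB K (ι₁ ⊕ ι₂) →ₗ[ℂ] N}
    (h : ∀ (f₁ : FinSB K ι₁) (f₂ : FinSB K ι₂),
      F (finSumEquiv K ι₁ ι₂ (f₁ ⊗ₜ f₂)) = G (finSumEquiv K ι₁ ι₂ (f₁ ⊗ₜ f₂))) :
    F = G := by
  have hc : F ∘ₗ (finSumEquiv K ι₁ ι₂).toLinearMap = G ∘ₗ (finSumEquiv K ι₁ ι₂).toLinearMap :=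
    TensorProduct.ext' fun f₁ f₂ => h f₁ f₂
  apply LinearMap.ext
  intro Φ
  have := LinearMap.congr_fun hc ((finSumEquiv K ι₁ ι₂).symm Φ)
  simpa only [LinearMap.coe_comp, Function.comp_apply, LinearEquiv.coe_coe,
    LinearEquiv.apply_symm_apply] using this

/-! ## 3. Product operators `B₁ ⊠ B₂` on `𝒮((𝔸_K^∞)^{ι₁ ⊕ ι₂})` -/

/-- **The product operator** `B₁ ⊠ B₂` of linear endomorphisms of the two finite factors, as a linear
endomorphism of `𝒮((𝔸_K^∞)^{ι₁ ⊕ ι₂})` (transport of `TensorProduct.map B₁ B₂` along `finSumEquiv`). [folklore] -/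
def finSumEnd (B₁ : FinSB K ι₁ →ₗ[ℂ] FinSB K ι₁) (B₂ : FinSB K ι₂ →ₗ[ℂ] FinSB K ι₂) :
    FinSB K (ι₁ ⊕ ι₂) →ₗ[ℂ] FinSB K (ι₁ ⊕ ι₂) :=
  (finSumEquiv K ι₁ ι₂).toLinearMap ∘ₗ TensorProduct.map B₁ B₂ ∘ₗ (finSumEquiv K ι₁ ι₂).symm.toLinearMap

/-- `(B₁ ⊠ B₂)(f₁ ⊠ f₂) = B₁ f₁ ⊠ B₂ f₂`. [folklore] -/
theorem finSumEnd_apply_tmul (B₁ : FinSB K ι₁ →ₗ[ℂ] FinSB K ι₁) (B₂ : FinSB K ι₂ →ₗ[ℂ] FinSB K ι₂)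
    (f₁ : FinSB K ι₁) (f₂ : FinSB K ι₂) :
    finSumEnd B₁ B₂ (finSumEquiv K ι₁ ι₂ (f₁ ⊗ₜ f₂)) = finSumEquiv K ι₁ ι₂ (B₁ f₁ ⊗ₜ B₂ f₂) := by
  simp only [finSumEnd, LinearMap.coe_comp, Function.comp_apply, LinearEquiv.coe_coe,
    LinearEquiv.symm_apply_apply, TensorProduct.map_tmul]

/-- `(B₁ ⊠ B₂)(f₁ ⊠ f₂)` as a function. [folklore] -/
theorem coe_finSumEnd_apply_tmul (B₁ : FinSB K ι₁ →ₗ[ℂ] FinSB K ι₁) (B₂ : FinSB K ι₂ →ₗ[ℂ] FinSB K ι₂)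
    (f₁ : FinSB K ι₁) (f₂ : FinSB K ι₂) :
    ((finSumEnd B₁ B₂ (finSumEquiv K ι₁ ι₂ (f₁ ⊗ₜ f₂)) : FinSB K (ι₁ ⊕ ι₂)) :
        (ι₁ ⊕ ι₂ → FiniteAdeleRing (𝓞 K) K) → ℂ) =
      fun v => ((B₁ f₁ : FinSB K ι₁) : (ι₁ → FiniteAdeleRing (𝓞 K) K) → ℂ) (resInl v) *
        ((B₂ f₂ : FinSB K ι₂) : (ι₂ → FiniteAdeleRing (𝓞 K) K) → ℂ) (resInr v) := by
  rw [finSumEnd_apply_tmul, coe_finSumEquiv_tmul]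

/-- `1 ⊠ 1 = 1`. [folklore] -/
theorem finSumEnd_id :
    finSumEnd (K := K) (ι₁ := ι₁) (ι₂ := ι₂) LinearMap.id LinearMap.id = LinearMap.id := by
  apply linearMap_ext_box
  intro f₁ f₂
  rw [finSumEnd_apply_tmul]
  rfl

/-- **Functoriality**: `(B₁ ∘ B₁') ⊠ (B₂ ∘ B₂') = (B₁ ⊠ B₂) ∘ (B₁' ⊠ B₂')`. [folklore] -/
theorem finSumEnd_comp (B₁ B₁' : FinSB K ι₁ →ₗ[ℂ] FinSB K ι₁) (B₂ B₂' : FinSB K ι₂ →ₗ[ℂ] FinSB K ι₂) :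
    finSumEnd (B₁ ∘ₗ B₁') (B₂ ∘ₗ B₂') = finSumEnd B₁ B₂ ∘ₗ finSumEnd B₁' B₂' := by
  apply linearMap_ext_box
  intro f₁ f₂
  simp only [finSumEnd_apply_tmul, LinearMap.coe_comp, Function.comp_apply]

/-- `(B₁ ⊠ B₂) = (B₁ ⊠ 1) ∘ (1 ⊠ B₂)`. [folklore] -/
theorem finSumEnd_eq_comp (B₁ : FinSB K ι₁ →ₗ[ℂ] FinSB K ι₁) (B₂ : FinSB K ι₂ →ₗ[ℂ] FinSB K ι₂) :
    finSumEnd B₁ B₂ = finSumEnd B₁ LinearMap.id ∘ₗ finSumEnd LinearMap.id B₂ := by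
  rw [← finSumEnd_comp, LinearMap.comp_id, LinearMap.id_comp]

/-- `(B₁ ⊠ 1)` and `(1 ⊠ B₂)` commute. [folklore] -/
theorem finSumEnd_inl_comm_inr (B₁ : FinSB K ι₁ →ₗ[ℂ] FinSB K ι₁) (B₂ : FinSB K ι₂ →ₗ[ℂ] FinSB K ι₂) :
    finSumEnd B₁ LinearMap.id ∘ₗ finSumEnd LinearMap.id B₂ =
      finSumEnd LinearMap.id B₂ ∘ₗ finSumEnd B₁ LinearMap.id := by
  rw [← finSumEnd_comp, ← finSumEnd_comp, LinearMap.comp_id, LinearMap.id_comp, LinearMap.comp_id,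
    LinearMap.id_comp]

/-- **Product of automorphisms** `B₁ ⊠ B₂` as a linear automorphism of `𝒮((𝔸_K^∞)^{ι₁ ⊕ ι₂})`. [folklore] -/
def finSumAut (B₁ : FinSB K ι₁ ≃ₗ[ℂ] FinSB K ι₁) (B₂ : FinSB K ι₂ ≃ₗ[ℂ] FinSB K ι₂) :
    FinSB K (ι₁ ⊕ ι₂) ≃ₗ[ℂ] FinSB K (ι₁ ⊕ ι₂) :=
  (finSumEquiv K ι₁ ι₂).symm.trans ((TensorProduct.congr B₁ B₂).trans (finSumEquiv K ι₁ ι₂))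

/-- `finSumAut` as a linear map is `finSumEnd`. [folklore] -/
theorem coe_finSumAut (B₁ : FinSB K ι₁ ≃ₗ[ℂ] FinSB K ι₁) (B₂ : FinSB K ι₂ ≃ₗ[ℂ] FinSB K ι₂) :
    (finSumAut B₁ B₂ : FinSB K (ι₁ ⊕ ι₂) →ₗ[ℂ] FinSB K (ι₁ ⊕ ι₂)) =
      finSumEnd (B₁ : FinSB K ι₁ →ₗ[ℂ] FinSB K ι₁) (B₂ : FinSB K ι₂ →ₗ[ℂ] FinSB K ι₂) := by
  apply linearMap_ext_box
  intro f₁ f₂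
  rw [finSumEnd_apply_tmul]
  simp only [finSumAut, LinearEquiv.coe_coe, LinearEquiv.trans_apply, LinearEquiv.symm_apply_apply,
    TensorProduct.congr_tmul]

/-- `(B₁ ⊠ B₂)(f₁ ⊠ f₂) = B₁ f₁ ⊠ B₂ f₂` for automorphisms. [folklore] -/
theorem finSumAut_apply_tmul (B₁ : FinSB K ι₁ ≃ₗ[ℂ] FinSB K ι₁) (B₂ : FinSB K ι₂ ≃ₗ[ℂ] FinSB K ι₂)
    (f₁ : FinSB K ι₁) (f₂ : FinSB K ι₂) :
    finSumAut B₁ B₂ (finSumEquiv K ι₁ ι₂ (f₁ ⊗ₜ f₂)) = finSumEquiv K ι₁ ι₂ (B₁ f₁ ⊗ₜ B₂ f₂) := by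
  simp only [finSumAut, LinearEquiv.trans_apply, LinearEquiv.symm_apply_apply, TensorProduct.congr_tmul]

/-- `(B₁ ⊠ B₂)⁻¹ = B₁⁻¹ ⊠ B₂⁻¹`. [folklore] -/
theorem finSumAut_symm (B₁ : FinSB K ι₁ ≃ₗ[ℂ] FinSB K ι₁) (B₂ : FinSB K ι₂ ≃ₗ[ℂ] FinSB K ι₂) :
    (finSumAut B₁ B₂).symm = finSumAut B₁.symm B₂.symm := by
  apply LinearEquiv.toLinearMap_injective
  apply linearMap_ext_box
  intro f₁ f₂
  rw [LinearEquiv.coe_coe, LinearEquiv.coe_coe, finSumAut_apply_tmul, LinearEquiv.symm_apply_eq,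
    finSumAut_apply_tmul, LinearEquiv.apply_symm_apply, LinearEquiv.apply_symm_apply]

/-! ## 5. The finite Heisenberg operators over `ι₁ ⊕ ι₂` split as products -/

/-- **Translations split**: `T_k = T_{k|ι₁} ⊠ T_{k|ι₂}` on `𝒮((𝔸_K^∞)^{ι₁ ⊕ ι₂})`. [folklore] -/
theorem finTranslateSB_sum_eq_finSumEnd (k : ι₁ ⊕ ι₂ → FiniteAdeleRing (𝓞 K) K) :
    finTranslateSB K (ι₁ ⊕ ι₂) k =
      finSumEnd (finTranslateSB K ι₁ (resInl k)) (finTranslateSB K ι₂ (resInr k)) := by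
  apply linearMap_ext_box
  intro f₁ f₂
  rw [finSumEnd_apply_tmul]
  apply Subtype.ext
  rw [coe_finTranslateSB_apply, coe_finSumEquiv_tmul, coe_finSumEquiv_tmul]
  funext b
  rfl

/-- The character of a sum over `ι₁ ⊕ ι₂` splits. [folklore] -/
theorem finiteAdeleAddChar_sum_sum (y b : ι₁ ⊕ ι₂ → FiniteAdeleRing (𝓞 K) K) :
    (finiteAdeleAddChar K (∑ l, y l * b l) : ℂ) =
      (finiteAdeleAddChar K (∑ i, resInl y i * resInl b i) : ℂ) *
        (finiteAdeleAddChar K (∑ j, resInr y j * resInr b j) : ℂ) := by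
  rw [Fintype.sum_sum_type, AddChar.map_add_eq_mul, Circle.coe_mul]

/-- **Modulations split**: `M_y = M_{y|ι₁} ⊠ M_{y|ι₂}` on `𝒮((𝔸_K^∞)^{ι₁ ⊕ ι₂})`. [folklore] -/
theorem finModulateSB_sum_eq_finSumEnd (y : ι₁ ⊕ ι₂ → FiniteAdeleRing (𝓞 K) K) :
    finModulateSB K (ι₁ ⊕ ι₂) y =
      finSumEnd (finModulateSB K ι₁ (resInl y)) (finModulateSB K ι₂ (resInr y)) := by
  apply linearMap_ext_box
  intro f₁ f₂
  rw [finSumEnd_apply_tmul]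
  apply Subtype.ext
  rw [coe_finModulateSB_apply, coe_finSumEquiv_tmul, coe_finSumEquiv_tmul]
  funext b
  simp only [coe_finModulateSB_apply, finiteAdeleAddChar_sum_sum]
  ring

omit [Fintype ι₁] [Fintype ι₂] in
/-- Translation by `0` is the identity. [folklore] -/
theorem finTranslateSB_zero (ι : Type) :
    finTranslateSB K ι (0 : ι → FiniteAdeleRing (𝓞 K) K) = LinearMap.id := by
  apply LinearMap.ext
  intro f
  apply Subtype.ext
  rw [coe_finTranslateSB_apply, LinearMap.id_apply]
  funext b
  rw [zero_add]

omit [Fintype ι₁] [Fintype ι₂] in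
/-- Modulation by `0` is the identity. [folklore] -/
theorem finModulateSB_zero (ι : Type) [Fintype ι] :
    finModulateSB K ι (0 : ι → FiniteAdeleRing (𝓞 K) K) = LinearMap.id := by
  apply LinearMap.ext
  intro f
  apply Subtype.ext
  rw [coe_finModulateSB_apply, LinearMap.id_apply]
  funext b
  simp only [Pi.zero_apply, zero_mul, Finset.sum_const_zero, AddChar.map_zero_eq_one, Circle.coe_one, one_mul]

/-- An operator of the form `B₁ ⊠ 1` commutes with the translations `T_{(0, k₂)}` along `ι₂`. [folklore] -/
theorem finSumEnd_inl_comm_finTranslateSB (B₁ : FinSB K ι₁ →ₗ[ℂ] FinSB K ι₁) (k₂ : ι₂ → FiniteAdeleRing (𝓞 K) K) :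
    finSumEnd B₁ LinearMap.id ∘ₗ finTranslateSB K (ι₁ ⊕ ι₂) (Sum.elim 0 k₂) =
      finTranslateSB K (ι₁ ⊕ ι₂) (Sum.elim 0 k₂) ∘ₗ finSumEnd B₁ LinearMap.id := by
  rw [finTranslateSB_sum_eq_finSumEnd, resInl_elim, resInr_elim, finTranslateSB_zero, ← finSumEnd_comp,
    ← finSumEnd_comp, LinearMap.id_comp, LinearMap.comp_id, LinearMap.id_comp, LinearMap.comp_id]

/-- An operator of the form `B₁ ⊠ 1` commutes with the modulations `M_{(0, y₂)}` along `ι₂`. [folklore] -/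
theorem finSumEnd_inl_comm_finModulateSB (B₁ : FinSB K ι₁ →ₗ[ℂ] FinSB K ι₁) (y₂ : ι₂ → FiniteAdeleRing (𝓞 K) K) :
    finSumEnd B₁ LinearMap.id ∘ₗ finModulateSB K (ι₁ ⊕ ι₂) (Sum.elim 0 y₂) =
      finModulateSB K (ι₁ ⊕ ι₂) (Sum.elim 0 y₂) ∘ₗ finSumEnd B₁ LinearMap.id := by
  rw [finModulateSB_sum_eq_finSumEnd, resInl_elim, resInr_elim, finModulateSB_zero, ← finSumEnd_comp,
    ← finSumEnd_comp, LinearMap.id_comp, LinearMap.comp_id, LinearMap.id_comp, LinearMap.comp_id]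

/-- Symmetrically, `1 ⊠ B₂` commutes with the translations along `ι₁`. [folklore] -/
theorem finSumEnd_inr_comm_finTranslateSB (B₂ : FinSB K ι₂ →ₗ[ℂ] FinSB K ι₂) (k₁ : ι₁ → FiniteAdeleRing (𝓞 K) K) :
    finSumEnd LinearMap.id B₂ ∘ₗ finTranslateSB K (ι₁ ⊕ ι₂) (Sum.elim k₁ 0) =
      finTranslateSB K (ι₁ ⊕ ι₂) (Sum.elim k₁ 0) ∘ₗ finSumEnd LinearMap.id B₂ := by
  rw [finTranslateSB_sum_eq_finSumEnd, resInl_elim, resInr_elim, finTranslateSB_zero, ← finSumEnd_comp,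
    ← finSumEnd_comp, LinearMap.id_comp, LinearMap.comp_id, LinearMap.id_comp, LinearMap.comp_id]

/-- Symmetrically, `1 ⊠ B₂` commutes with the modulations along `ι₁`. [folklore] -/
theorem finSumEnd_inr_comm_finModulateSB (B₂ : FinSB K ι₂ →ₗ[ℂ] FinSB K ι₂) (y₁ : ι₁ → FiniteAdeleRing (𝓞 K) K) :
    finSumEnd LinearMap.id B₂ ∘ₗ finModulateSB K (ι₁ ⊕ ι₂) (Sum.elim y₁ 0) =
      finModulateSB K (ι₁ ⊕ ι₂) (Sum.elim y₁ 0) ∘ₗ finSumEnd LinearMap.id B₂ := by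
  rw [finModulateSB_sum_eq_finSumEnd, resInl_elim, resInr_elim, finModulateSB_zero, ← finSumEnd_comp,
    ← finSumEnd_comp, LinearMap.id_comp, LinearMap.comp_id, LinearMap.id_comp, LinearMap.comp_id]

end FinSum

/-! ## 4. The adelic corollary: `𝒮(𝔸_K^{ι₁ ⊕ ι₂}) ≅ 𝓢((K ⊗ ℝ)^{ι₁ ⊕ ι₂}) ⊗ (𝒮((𝔸^∞)^{ι₁}) ⊗ 𝒮((𝔸^∞)^{ι₂}))` -/

section Adelic

variable (K : Type) [Field K] [NumberField K] (ι₁ ι₂ : Type) [Fintype ι₁] [Fintype ι₂]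

/-- **`𝒮(𝔸_K^{ι₁ ⊕ ι₂}) ≅ 𝓢((K ⊗ ℝ)^{ι₁ ⊕ ι₂}) ⊗_ℂ (𝒮((𝔸_K^∞)^{ι₁}) ⊗_ℂ 𝒮((𝔸_K^∞)^{ι₂}))`** — the archimedean
factor is NOT split (the Schwartz space of a product is not an algebraic tensor product), the finite one is.
[folklore] -/
def piSchwartzBruhatSumEquiv :
    𝓢((ι₁ ⊕ ι₂ → mixedSpace K), ℂ) ⊗[ℂ] (FinSB K ι₁ ⊗[ℂ] FinSB K ι₂) ≃ₗ[ℂ] ↥(piSchwartzBruhat K (ι₁ ⊕ ι₂)) :=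
  (TensorProduct.congr (LinearEquiv.refl ℂ _) (finSumEquiv K ι₁ ι₂)).trans (piSchwartzBruhatEquiv K (ι₁ ⊕ ι₂))

/-- On triple tensors. [folklore] -/
theorem piSchwartzBruhatSumEquiv_tmul (Φinf : 𝓢((ι₁ ⊕ ι₂ → mixedSpace K), ℂ)) (f₁ : FinSB K ι₁)
    (f₂ : FinSB K ι₂) :
    piSchwartzBruhatSumEquiv K ι₁ ι₂ (Φinf ⊗ₜ (f₁ ⊗ₜ f₂)) =
      piSchwartzBruhatEquiv K (ι₁ ⊕ ι₂) (Φinf ⊗ₜ finSumEquiv K ι₁ ι₂ (f₁ ⊗ₜ f₂)) := by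
  simp only [piSchwartzBruhatSumEquiv, LinearEquiv.trans_apply, TensorProduct.congr_tmul,
    LinearEquiv.refl_apply]

/-- The triple product `Φ_∞ ⊗ (f₁ ⊠ f₂)` as a function on `𝔸_K^{ι₁ ⊕ ι₂}`. [folklore] -/
theorem coe_piSchwartzBruhatSumEquiv_tmul (Φinf : 𝓢((ι₁ ⊕ ι₂ → mixedSpace K), ℂ)) (f₁ : FinSB K ι₁)
    (f₂ : FinSB K ι₂) :
    ((piSchwartzBruhatSumEquiv K ι₁ ι₂ (Φinf ⊗ₜ (f₁ ⊗ₜ f₂)) : ↥(piSchwartzBruhat K (ι₁ ⊕ ι₂))) :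
        (ι₁ ⊕ ι₂ → AdeleRing (𝓞 K) K) → ℂ) =
      fun v => Φinf (piArch K (ι₁ ⊕ ι₂) v) *
        ((f₁ : (ι₁ → FiniteAdeleRing (𝓞 K) K) → ℂ) (resInl (piFinite K (ι₁ ⊕ ι₂) v)) *
          (f₂ : (ι₂ → FiniteAdeleRing (𝓞 K) K) → ℂ) (resInr (piFinite K (ι₁ ⊕ ι₂) v))) := by
  rw [piSchwartzBruhatSumEquiv_tmul, coe_piSchwartzBruhatEquiv_tmul, coe_finSumEquiv_tmul]

variable {K ι₁ ι₂}

omit [Fintype ι₁] [Fintype ι₂] in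
/-- Archimedean coordinates commute with restriction to `ι₁`. [folklore] -/
@[simp] theorem resInl_piArch (v : ι₁ ⊕ ι₂ → AdeleRing (𝓞 K) K) :
    resInl (piArch K (ι₁ ⊕ ι₂) v) = piArch K ι₁ (resInl v) := rfl

omit [Fintype ι₁] [Fintype ι₂] in
/-- Archimedean coordinates commute with restriction to `ι₂`. [folklore] -/
@[simp] theorem resInr_piArch (v : ι₁ ⊕ ι₂ → AdeleRing (𝓞 K) K) :
    resInr (piArch K (ι₁ ⊕ ι₂) v) = piArch K ι₂ (resInr v) := rfl

omit [Fintype ι₁] [Fintype ι₂] in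
/-- Finite coordinates commute with restriction to `ι₁`. [folklore] -/
@[simp] theorem resInl_piFinite (v : ι₁ ⊕ ι₂ → AdeleRing (𝓞 K) K) :
    resInl (piFinite K (ι₁ ⊕ ι₂) v) = piFinite K ι₁ (resInl v) := rfl

omit [Fintype ι₁] [Fintype ι₂] in
/-- Finite coordinates commute with restriction to `ι₂`. [folklore] -/
@[simp] theorem resInr_piFinite (v : ι₁ ⊕ ι₂ → AdeleRing (𝓞 K) K) :
    resInr (piFinite K (ι₁ ⊕ ι₂) v) = piFinite K ι₂ (resInr v) := rfl

omit [Fintype ι₁] [Fintype ι₂] in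
/-- The splitting commutes with restriction to `ι₁`. [folklore] -/
theorem resInl_piAdeleSplit (a : ι₁ ⊕ ι₂ → mixedSpace K) (b : ι₁ ⊕ ι₂ → FiniteAdeleRing (𝓞 K) K) :
    resInl (piAdeleSplit K (ι₁ ⊕ ι₂) (a, b)) = piAdeleSplit K ι₁ (resInl a, resInl b) := rfl

omit [Fintype ι₁] [Fintype ι₂] in
/-- The splitting commutes with restriction to `ι₂`. [folklore] -/
theorem resInr_piAdeleSplit (a : ι₁ ⊕ ι₂ → mixedSpace K) (b : ι₁ ⊕ ι₂ → FiniteAdeleRing (𝓞 K) K) :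
    resInr (piAdeleSplit K (ι₁ ⊕ ι₂) (a, b)) = piAdeleSplit K ι₂ (resInr a, resInr b) := rfl

/-- **Extensionality on triple products**: two linear maps out of `𝒮(𝔸_K^{ι₁ ⊕ ι₂})` agreeing on all
`Φ_∞ ⊗ (f₁ ⊠ f₂)` are equal. [folklore] -/
theorem linearMap_ext_arch_box {N : Type*} [AddCommMonoid N] [Module ℂ N]
    {F G : ↥(piSchwartzBruhat K (ι₁ ⊕ ι₂)) →ₗ[ℂ] N}
    (h : ∀ (Φinf : 𝓢((ι₁ ⊕ ι₂ → mixedSpace K), ℂ)) (f₁ : FinSB K ι₁) (f₂ : FinSB K ι₂),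
      F (piSchwartzBruhatEquiv K (ι₁ ⊕ ι₂) (Φinf ⊗ₜ finSumEquiv K ι₁ ι₂ (f₁ ⊗ₜ f₂))) =
        G (piSchwartzBruhatEquiv K (ι₁ ⊕ ι₂) (Φinf ⊗ₜ finSumEquiv K ι₁ ι₂ (f₁ ⊗ₜ f₂)))) :
    F = G := by
  apply linearMap_ext_tensor
  intro Φinf f
  have hc : F ∘ₗ (piSchwartzBruhatEquiv K (ι₁ ⊕ ι₂)).toLinearMap ∘ₗ (TensorProduct.mk ℂ _ _ Φinf) ∘ₗ
        (finSumEquiv K ι₁ ι₂).toLinearMap =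
      G ∘ₗ (piSchwartzBruhatEquiv K (ι₁ ⊕ ι₂)).toLinearMap ∘ₗ (TensorProduct.mk ℂ _ _ Φinf) ∘ₗ
        (finSumEquiv K ι₁ ι₂).toLinearMap :=
    TensorProduct.ext' fun f₁ f₂ => h Φinf f₁ f₂
  have := LinearMap.congr_fun hc ((finSumEquiv K ι₁ ι₂).symm f)
  simpa only [LinearMap.coe_comp, Function.comp_apply, LinearEquiv.coe_coe, TensorProduct.mk_apply,
    LinearEquiv.apply_symm_apply] using this

/-- **`A ⊗ (B₁ ⊠ B₂)` on triple products**: `adelicTensorEnd A (finSumEnd B₁ B₂) (Φ_∞ ⊗ (f₁ ⊠ f₂)) =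
A Φ_∞ ⊗ (B₁ f₁ ⊠ B₂ f₂)`. [folklore] -/
theorem adelicTensorEnd_finSumEnd_apply_tmul
    (A : 𝓢((ι₁ ⊕ ι₂ → mixedSpace K), ℂ) →ₗ[ℂ] 𝓢((ι₁ ⊕ ι₂ → mixedSpace K), ℂ))
    (B₁ : FinSB K ι₁ →ₗ[ℂ] FinSB K ι₁) (B₂ : FinSB K ι₂ →ₗ[ℂ] FinSB K ι₂)
    (Φinf : 𝓢((ι₁ ⊕ ι₂ → mixedSpace K), ℂ)) (f₁ : FinSB K ι₁) (f₂ : FinSB K ι₂) :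
    adelicTensorEnd A (finSumEnd B₁ B₂)
        (piSchwartzBruhatEquiv K (ι₁ ⊕ ι₂) (Φinf ⊗ₜ finSumEquiv K ι₁ ι₂ (f₁ ⊗ₜ f₂))) =
      piSchwartzBruhatEquiv K (ι₁ ⊕ ι₂) (A Φinf ⊗ₜ finSumEquiv K ι₁ ι₂ (B₁ f₁ ⊗ₜ B₂ f₂)) := by
  rw [adelicTensorEnd_apply_tmul, finSumEnd_apply_tmul]

/-- The same, as a function on `𝔸_K^{ι₁ ⊕ ι₂}`. [folklore] -/
theorem coe_adelicTensorEnd_finSumEnd_apply_tmul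
    (A : 𝓢((ι₁ ⊕ ι₂ → mixedSpace K), ℂ) →ₗ[ℂ] 𝓢((ι₁ ⊕ ι₂ → mixedSpace K), ℂ))
    (B₁ : FinSB K ι₁ →ₗ[ℂ] FinSB K ι₁) (B₂ : FinSB K ι₂ →ₗ[ℂ] FinSB K ι₂)
    (Φinf : 𝓢((ι₁ ⊕ ι₂ → mixedSpace K), ℂ)) (f₁ : FinSB K ι₁) (f₂ : FinSB K ι₂) :
    ((adelicTensorEnd A (finSumEnd B₁ B₂)
        (piSchwartzBruhatEquiv K (ι₁ ⊕ ι₂) (Φinf ⊗ₜ finSumEquiv K ι₁ ι₂ (f₁ ⊗ₜ f₂))) :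
          ↥(piSchwartzBruhat K (ι₁ ⊕ ι₂))) : (ι₁ ⊕ ι₂ → AdeleRing (𝓞 K) K) → ℂ) =
      fun v => A Φinf (piArch K (ι₁ ⊕ ι₂) v) *
        (((B₁ f₁ : FinSB K ι₁) : (ι₁ → FiniteAdeleRing (𝓞 K) K) → ℂ) (resInl (piFinite K (ι₁ ⊕ ι₂) v)) *
          ((B₂ f₂ : FinSB K ι₂) : (ι₂ → FiniteAdeleRing (𝓞 K) K) → ℂ) (resInr (piFinite K (ι₁ ⊕ ι₂) v))) := by
  rw [adelicTensorEnd_finSumEnd_apply_tmul, coe_piSchwartzBruhatEquiv_tmul, coe_finSumEquiv_tmul]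

end Adelic

end Literature.NumberTheory.Automorphic
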